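import Summits.SmoothPoincare4.SmoothPoincare4.Theses.CongruenceShadows
import Literature.Topology.FourManifolds.TrisectionFunctorSPC4Proofs
import Literature.Topology.FourManifolds.TrisectionsProofs

/-!
# `AgkCor6Sufficiency` — negative-side support V: anatomy of a disproof, and the load-bearing instance of rigidity (b′)

Companion of `StablyTrivialTight.lean`, `UnbalancedFalse.lean`, `AnyGroupFalse.lean`,
`DownwardClosed.lean` (crux item `stmt-SmoothPoincare4-10894`, work file
`Cruxes/AgkCor6Sufficiency/Disproof.lean` §8).  The crux is `X → SmoothPoincare4`, `X` = AGK's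
Cor. 6 condition "every `(3k, k)` group trisection of the trivial group is stably trivial", so
`¬ crux ↔ X ∧ ¬ SmoothPoincare4`, and `¬ SmoothPoincare4` unpacks to an exotic `4`-sphere
(`not_smoothPoincare4_iff_exotic`, `not_agkCor6Sufficiency_iff_exotic`).

Through the tree the crux is proved from three named leaves
(`Literature.Topology.FourManifolds.spc4_of_forall_isStablyTrivial_of_three_leaves`): Gay–Kirby Thm. 4
(`exists_isBalancedGKTrisection`, DISCHARGED: `exists_isBalancedGKTrisection_holds`), (b′) rigidity
`diffeomorph_of_iso_groupGKTrisectionOf` and (c′) stabilisation `exists_stabilized_gkTrisection`;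
hence `¬ crux → ¬ ((b′) ∧ (c′))` (`not_agkCor6Sufficiency_imp_not_leaves`).  Sharper: the in-tree
proof uses (b′) only AGAINST THE ROUND SPHERE and only for HOMOTOPY `4`-SPHERES — the
"load-bearing instance", spelled out as the hypothesis `hR` below — and that instance follows
from (b′) (`rigidityVsSphere_of_rigidity`) but ALSO from the summit itself
(`rigidityVsSphere_of_smoothPoincare4`).  Re-running the assembly with `hR` in place of (b′)
(`not_agkHypothesis_of_not_smoothPoincare4`, stated contrapositively) gives, granted (c′),
`¬ crux ↔ X ∧ ¬ (load-bearing rigidity)` (`not_agkCor6Sufficiency_iff_of_stabilization`): every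
conjunct of a disproof of the crux is an exotic `S⁴` in disguise, and the load-bearing leaf
instance admits no junk-model refutation either.  Nothing here concludes the crux, `X`, or the
summit.

References: A. Abrams, D. Gay, R. Kirby, *Group trisections and smooth 4-manifolds*, Geom. Topol.
22 (2018) 1537–1545, Thm. 5 and Cor. 6 (p. 1541); D. Gay, R. Kirby, *Trisecting 4-manifolds*,
Geom. Topol. 20 (2016), Thm. 4.
-/

noncomputable section

namespace Summit.SmoothPoincare4.SmoothPoincare4.Theorems.AgkCor6Sufficiency.Negative

open Literature.Topology.FourManifolds ContinuousMap
open scoped Manifold ContDiff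
open Summit.SmoothPoincare4.SmoothPoincare4.Theses.CongruenceShadows (AgkCor6Sufficiency)

/-- The round `4`-sphere of Mathlib. -/
local notation "𝕊⁴" => (Metric.sphere (0 : EuclideanSpace ℝ (Fin 5)) 1)

/-! ## Unpacking `¬ SmoothPoincare4` -/

/-- `¬ SmoothPoincare4` is the existence of an exotic `4`-sphere in Lean's sense: a Hausdorff
second countable `C^∞` `4`-manifold homotopy equivalent but not diffeomorphic to `𝕊⁴`. [folklore] -/
theorem not_smoothPoincare4_iff_exotic : ¬ _root_.SmoothPoincare4 ↔
    ∃ (M : Type) (_ : TopologicalSpace M) (_ : T2Space M) (_ : SecondCountableTopology M)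
      (_ : ChartedSpace (EuclideanSpace ℝ (Fin 4)) M) (_ : IsManifold (𝓡 4) ∞ M),
      Nonempty (M ≃ₕ 𝕊⁴) ∧ IsEmpty (M ≃ₘ⟮𝓡 4, 𝓡 4⟯ 𝕊⁴) := by
  constructor
  · intro h
    by_contra hne
    apply h
    intro M _ _ _ cs im e
    by_contra hd
    exact hne ⟨M, inferInstance, inferInstance, inferInstance, cs, im, ⟨e⟩, not_nonempty_iff.1 hd⟩
  · rintro ⟨M, _, _, _, cs, im, ⟨e⟩, hempty⟩ h
    exact not_nonempty_iff.2 hempty (h M cs im e)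

/-- **`¬ crux` = AGK's condition `X` together with an exotic `4`-sphere** (the crux is literally
`X → SmoothPoincare4`). [cite: AbramsGayKirby2018, Cor. 6 (p. 1541)] -/
theorem not_agkCor6Sufficiency_iff_exotic : ¬ AgkCor6Sufficiency ↔
    (∀ (k : ℕ) (K : TrisectionKernels (3 * k)),
        IsGroupTrisection (3 * k) k (PUnit : Type) K → K.IsStablyTrivial) ∧
    ∃ (M : Type) (_ : TopologicalSpace M) (_ : T2Space M) (_ : SecondCountableTopology M)
      (_ : ChartedSpace (EuclideanSpace ℝ (Fin 4)) M) (_ : IsManifold (𝓡 4) ∞ M),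
      Nonempty (M ≃ₕ 𝕊⁴) ∧ IsEmpty (M ≃ₘ⟮𝓡 4, 𝓡 4⟯ 𝕊⁴) := by
  rw [← not_smoothPoincare4_iff_exotic]
  exact Classical.not_imp

/-! ## Through the tree: `¬ crux` refutes `(b′) ∧ (c′)` -/

/-- **A disproof of the crux refutes the conjunction of the two open leaves of its in-tree proof**:
Gay–Kirby Thm. 4 being discharged (`exists_isBalancedGKTrisection_holds`), `¬ crux` contradicts
(b′) `diffeomorph_of_iso_groupGKTrisectionOf` ∧ (c′) `exists_stabilized_gkTrisection` (universe `0`)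
through `spc4_of_forall_isStablyTrivial_of_three_leaves`. [cite: AbramsGayKirby2018, Cor. 6 (p. 1541); Thm. 5 (p. 1541)] -/
theorem not_agkCor6Sufficiency_imp_not_leaves (h : ¬ AgkCor6Sufficiency) :
    ¬ (diffeomorph_of_iso_groupGKTrisectionOf.{0} ∧ exists_stabilized_gkTrisection.{0}) := by
  rintro ⟨hb, hc⟩
  obtain ⟨hX, hns⟩ := Classical.not_imp.1 h
  exact hns fun M _ _ _ =>
    spc4_of_forall_isStablyTrivial_of_three_leaves exists_isBalancedGKTrisection_holds hb hc hX M

/-! ## The load-bearing instance of (b′)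

"Load-bearing rigidity" is the hypothesis `hR` of the theorems below: a closed connected oriented
smooth `4`-manifold `M` HOMOTOPY EQUIVALENT TO `𝕊⁴`, carrying a balanced Gay–Kirby trisection
whose kernel triple is isomorphic to that of a balanced trisection of the round `𝕊⁴` of the same
type, is diffeomorphic to `𝕊⁴`.  It is stated inline (no new `Prop` constant). -/

/-- (b′) implies load-bearing rigidity (specialisation `X' := 𝕊⁴`; the homotopy equivalence is not
even used). [cite: AbramsGayKirby2018, Thm. 5 (p. 1541)] -/
theorem rigidityVsSphere_of_rigidity (hb : diffeomorph_of_iso_groupGKTrisectionOf.{0})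
    (M : Type) [TopologicalSpace M] [T2Space M] [SecondCountableTopology M]
    [ChartedSpace (EuclideanSpace ℝ (Fin 4)) M] [IsManifold (𝓡 4) ∞ M] [CompactSpace M]
    [ConnectedSpace M] (o : SmoothOrientation (𝓡 4) M) (_e : M ≃ₕ 𝕊⁴)
    (o' : SmoothOrientation (𝓡 4) 𝕊⁴)
    (g k : ℕ) (T : Fin 3 → Set M) (S' : Fin 3 → Set 𝕊⁴)
    (hT : IsBalancedGKTrisection M g k T) (hS' : IsBalancedGKTrisection 𝕊⁴ g k S')
    (y₀ : centralSurface T) (x₀' : centralSurface S')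
    (ν : SurfaceGroup g ≃* FundamentalGroup (centralSurface T) y₀)
    (μ' : SurfaceGroup g ≃* FundamentalGroup (centralSurface S') x₀')
    (hIso : TrisectionKernels.Iso (groupGKTrisectionOf hT y₀ ν) (groupGKTrisectionOf hS' x₀' μ')) :
    Nonempty (M ≃ₘ⟮𝓡 4, 𝓡 4⟯ 𝕊⁴) :=
  hb M o 𝕊⁴ o' g k T S' hT hS' y₀ x₀' ν μ' hIso

/-- **Load-bearing rigidity follows from the summit** (forget the trisections): so the instance of
(b′) that the crux's proof uses admits no refutation short of an exotic `S⁴`, junk models of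
`IsBalancedGKTrisection` included. [folklore] -/
theorem rigidityVsSphere_of_smoothPoincare4 (h : _root_.SmoothPoincare4)
    (M : Type) [TopologicalSpace M] [T2Space M] [SecondCountableTopology M]
    [ChartedSpace (EuclideanSpace ℝ (Fin 4)) M] [IsManifold (𝓡 4) ∞ M] [CompactSpace M]
    [ConnectedSpace M] (_o : SmoothOrientation (𝓡 4) M) (e : M ≃ₕ 𝕊⁴)
    (_o' : SmoothOrientation (𝓡 4) 𝕊⁴)
    (g k : ℕ) (T : Fin 3 → Set M) (S' : Fin 3 → Set 𝕊⁴)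
    (hT : IsBalancedGKTrisection M g k T) (hS' : IsBalancedGKTrisection 𝕊⁴ g k S')
    (y₀ : centralSurface T) (x₀' : centralSurface S')
    (ν : SurfaceGroup g ≃* FundamentalGroup (centralSurface T) y₀)
    (μ' : SurfaceGroup g ≃* FundamentalGroup (centralSurface S') x₀')
    (_hIso : TrisectionKernels.Iso (groupGKTrisectionOf hT y₀ ν) (groupGKTrisectionOf hS' x₀' μ')) :
    Nonempty (M ≃ₘ⟮𝓡 4, 𝓡 4⟯ 𝕊⁴) :=
  h M ‹_› ‹_› e

/-- **The in-tree assembly re-run with load-bearing rigidity only, stated contrapositively**: given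
load-bearing rigidity `hR` and (c′), an exotic `4`-sphere refutes AGK's condition `X`.  (Proof =
`spc4_of_forall_isStablyTrivial_of_facts` with its discharged leaves — GK Thm. 4, GK Remark 2, (g′),
(a′) — plugged in and `hR` at the last step.) [cite: AbramsGayKirby2018, Cor. 6 (p. 1541)] -/
theorem not_agkHypothesis_of_not_smoothPoincare4
    (hR : ∀ (M : Type) [TopologicalSpace M] [T2Space M] [SecondCountableTopology M]
      [ChartedSpace (EuclideanSpace ℝ (Fin 4)) M] [IsManifold (𝓡 4) ∞ M] [CompactSpace M]
      [ConnectedSpace M] (_ : SmoothOrientation (𝓡 4) M) (_ : M ≃ₕ 𝕊⁴)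
      (_ : SmoothOrientation (𝓡 4) 𝕊⁴)
      (g k : ℕ) (T : Fin 3 → Set M) (S' : Fin 3 → Set 𝕊⁴)
      (hT : IsBalancedGKTrisection M g k T) (hS' : IsBalancedGKTrisection 𝕊⁴ g k S')
      (y₀ : centralSurface T) (x₀' : centralSurface S')
      (ν : SurfaceGroup g ≃* FundamentalGroup (centralSurface T) y₀)
      (μ' : SurfaceGroup g ≃* FundamentalGroup (centralSurface S') x₀'),
      TrisectionKernels.Iso (groupGKTrisectionOf hT y₀ ν) (groupGKTrisectionOf hS' x₀' μ') →
        Nonempty (M ≃ₘ⟮𝓡 4, 𝓡 4⟯ 𝕊⁴))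
    (hc : exists_stabilized_gkTrisection.{0}) (hns : ¬ _root_.SmoothPoincare4) :
    ¬ ∀ (k : ℕ) (K : TrisectionKernels (3 * k)),
        IsGroupTrisection (3 * k) k (PUnit : Type) K → K.IsStablyTrivial := by
  intro hst
  apply hns
  intro M _ _ _ _ _ e
  haveI : CompactSpace M := compactSpace_of_homotopyEquiv_sphere_four_holds M e
  obtain ⟨o⟩ := isOrientable_of_homotopyEquiv_sphere_four_holds M e
  haveI : SimplyConnectedSpace 𝕊⁴ := simplyConnectedSpace_sphere_four_holds
  haveI : SimplyConnectedSpace M := e.simplyConnectedSpace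
  obtain ⟨o'⟩ := isOrientable_sphere_holds 4
  obtain ⟨g, k, S, -, hS⟩ := exists_isBalancedGKTrisection_holds M o
  obtain rfl : g = 3 * k :=
    gkTrisection_genus_eq_sum_of_homotopyEquiv_sphere_holds.balanced M o hS e
  obtain ⟨x₀, ⟨μ⟩⟩ := exists_marking_centralSurface_of_gkTrisection_holds M o (3 * k) k S hS
  have hK : IsGroupTrisection (3 * k) k (PUnit : Type) (groupGKTrisectionOf hS x₀ μ) :=
    (isGroupTrisection_groupGKTrisectionOf_holds M o (3 * k) k S hS x₀ μ).punit_of_subsingleton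
  obtain ⟨n, m, hnm, hiso⟩ := hst k _ hK
  obtain ⟨Sₙ, hₙ, xₙ, μₙ, hEq⟩ := exists_gkTrisection_stabilizeIter hc M o hS x₀ μ n
  rw [← hEq] at hiso
  obtain ⟨S', hS', x', μ', hiso'⟩ := sphere_gkTrisections_of_stabilization hc m
  -- eliminate the genus bookkeeping `3 + 3m = 3k + 3n`, `1 + m = k + n`
  have key : ∀ {G₂ k₂ : ℕ} {S₂ : Fin 3 → Set 𝕊⁴} (hS₂ : IsBalancedGKTrisection 𝕊⁴ G₂ k₂ S₂)
      (x₂ : centralSurface S₂) (μ₂ : SurfaceGroup G₂ ≃* FundamentalGroup (centralSurface S₂) x₂)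
      (K₂ : TrisectionKernels G₂) (_ : TrisectionKernels.Iso (groupGKTrisectionOf hS₂ x₂ μ₂) K₂)
      (eg : G₂ = 3 * k + 3 * n) (_ : k₂ = k + n)
      (_ : TrisectionKernels.Iso (groupGKTrisectionOf hₙ xₙ μₙ) (K₂.cast eg)),
      Nonempty (M ≃ₘ⟮𝓡 4, 𝓡 4⟯ 𝕊⁴) := by
    intro G₂ k₂ S₂ hS₂ x₂ μ₂ K₂ hK₂ eg ek hIso
    subst eg ek
    rw [TrisectionKernels.cast_rfl] at hIso
    exact hR M o e o' _ _ Sₙ S₂ hₙ hS₂ xₙ x₂ μₙ μ₂ (hIso.trans hK₂.symm)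
  exact key hS' x' μ' _ hiso' hnm (by omega) hiso

/-- **Granted (c′), a disproof of the crux is exactly: AGK's condition `X` AND a failure of
load-bearing rigidity** — and the latter alone contradicts the summit
(`rigidityVsSphere_of_smoothPoincare4`). [cite: AbramsGayKirby2018, Cor. 6 (p. 1541)] -/
theorem not_agkCor6Sufficiency_iff_of_stabilization (hc : exists_stabilized_gkTrisection.{0}) :
    ¬ AgkCor6Sufficiency ↔
      ((∀ (k : ℕ) (K : TrisectionKernels (3 * k)),
          IsGroupTrisection (3 * k) k (PUnit : Type) K → K.IsStablyTrivial) ∧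
        ¬ ∀ (M : Type) [TopologicalSpace M] [T2Space M] [SecondCountableTopology M]
          [ChartedSpace (EuclideanSpace ℝ (Fin 4)) M] [IsManifold (𝓡 4) ∞ M] [CompactSpace M]
          [ConnectedSpace M] (_ : SmoothOrientation (𝓡 4) M) (_ : M ≃ₕ 𝕊⁴)
          (_ : SmoothOrientation (𝓡 4) 𝕊⁴)
          (g k : ℕ) (T : Fin 3 → Set M) (S' : Fin 3 → Set 𝕊⁴)
          (hT : IsBalancedGKTrisection M g k T) (hS' : IsBalancedGKTrisection 𝕊⁴ g k S')
          (y₀ : centralSurface T) (x₀' : centralSurface S')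
          (ν : SurfaceGroup g ≃* FundamentalGroup (centralSurface T) y₀)
          (μ' : SurfaceGroup g ≃* FundamentalGroup (centralSurface S') x₀'),
          TrisectionKernels.Iso (groupGKTrisectionOf hT y₀ ν) (groupGKTrisectionOf hS' x₀' μ') →
            Nonempty (M ≃ₘ⟮𝓡 4, 𝓡 4⟯ 𝕊⁴)) := by
  constructor
  · intro h
    obtain ⟨hX, hns⟩ := Classical.not_imp.1 h
    exact ⟨hX, fun hR => not_agkHypothesis_of_not_smoothPoincare4 hR hc hns hX⟩
  · rintro ⟨hX, hnR⟩ h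
    exact hnR fun M _ _ _ _ _ _ _ o e o' g k T S' hT hS' y₀ x₀' ν μ' hIso =>
      rigidityVsSphere_of_smoothPoincare4 (h hX) M o e o' g k T S' hT hS' y₀ x₀' ν μ' hIso

end Summit.SmoothPoincare4.SmoothPoincare4.Theorems.AgkCor6Sufficiency.Negative

end
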